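import Summits.ResolutionOfSingularities.ResolutionOfSingularities.Theorems.WeightedInvariantLocalWeightedDropNCTameBinomialRung
import Summits.ResolutionOfSingularities.ResolutionOfSingularities.Theorems.WeightedInvariantLocalWeightedDropNCOrderGrowth
import Summits.ResolutionOfSingularities.ResolutionOfSingularities.Theorems.WeightedInvariantLocalWeightedDropNCToricRungClosed
import Summits.ResolutionOfSingularities.ResolutionOfSingularities.Theorems.WeightedInvariantLocalWeightedDropNCGameTransport
import Summits.ResolutionOfSingularities.ResolutionOfSingularities.Theorems.WeightedInvariantLocalWeightedDropSpaceNCCountOfCJSB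

/-!
# W4.3 `LocalWeightedDrop` — TOT rung R7: TAME RELATIVE BINOMIALS (the Jung rung) — THE CLOSER: the rung HYPOTHESIS-FREE,
# the tame-suspension corollaries, and the wins handed to the engine

[OURS · L1 W4.3 · chain w43, engine crux `LocalWeightedDrop` stmt-ResolutionOfSingularities-8899, line `nc-game-transport`; R7 design and
kernel-checked sketch `tot_rung_r7_sketch.lean` (785e29c7255c4a72) by res-L1-w43-strat-1, landed verbatim as PART 1 `…NCTameBinomialEndGame`
(res-D-pv-006) + PART 2 `…NCTameBinomialRung` (res-D-pv-036, adoption hand); this closer = res-D-pv-036 (res-L1-w43-plan-1 DEALS gen 10 #3 (3),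
#4 (1)).  Bookkeeping on the programme's own NC count game; NOT a statement of the manuscript under review ([claim: Hironaka2017, status:
under-review]); nothing here is attributed to its author; closes no stub by name (`--supports stmt-ResolutionOfSingularities-8899`).]

THE THREE HYPOTHESES OF `totRungTameBinomial_of_toric` ARE TREE THEOREMS:
* `ToricStep (m + 1)` — `NCTransport.toricStep` (res-D-pv-006, p523576);
* `ToricEnd (m + 1)` — `NCTransport.toricEnd` (res-type-088, p521013);
* (O) `OrderGrowth (m + 1)` — `orderGrowth` below: the one-line glue to `NCTransport.order_slice_add_le_of_factor` (res-D-pv-036, p524604; the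
  order of a count-game position at most doubles (+1) per round; statement of (O) by res-L1-w43-strat-1).

CONTENTS.
* `orderGrowth : ∀ n, OrderGrowth n` — (O) discharged.
* **`totRungTameBinomial (m) : TOTRungTameBinomial m`** — TOT RUNG R7 WITH NO HYPOTHESIS, every `m`.
* `exists_winsIn_relBinom_closed` — the relative strategy hypothesis-free over EVERY field and any right block: `E · (M · x_R ^ d + h)` is won
  within finitely many rounds whenever `E · M · h` is and `(d : k) ≠ 0`.
* **`exists_winsIn_tameSuspension_closed`** (+ `_of_isUnit`, `_of_not_dvd`) — (K-c) of the `N = 4` tame census hypothesis-free, every field: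
  `∃ n, WinsIn GermIsNC n (X 2 ^ d + c)` for `c ≠ 0`, `(d : k) ≠ 0` (res-L1-w43-stub-2's `TameN4.tot_suspension_tame` wraps it).
* `exists_winsIn_tameSuspension_three_of_CJSB` — one dimension up, modulo ⟨F-32bR⟩ (Cossart–Jannsen–Saito, `exists_winsIn_germIsNC_of_CJSB`):
  `x_3 ^ d + c(x_0, x_1, x_2)` is won in FOUR variables for every non-zero surface germ `c` — a class of `HTOT 3`-instances (regime of W4|₄).
* `tameSuspension_ne_zero`, `won_of_dvd_tameSuspension_pow` — transport to the weighted game (`NCTransport.won_of_winsIn`, p507842): in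
  characteristic `p ∤ d`, every divisor of a power of a tame suspension `x_2 ^ d + c(x_0, x_1)` is in `CobordantGame.Won k 3` — fact-free.
-/

noncomputable section

open Literature.AlgebraicGeometry.Resolution

set_option linter.dupNamespace false -- mandated namespace of this single-conjunct summit

namespace Summit.ResolutionOfSingularities.ResolutionOfSingularities.Theorems

namespace NCTransport

open MvPowerSeries TameFourTupleDrop

variable {k : Type} [Field k]

/-! ## The three hypotheses discharged -/

/-- **(O) HOLDS**: `OrderGrowth n` for every `n` — the one-line glue to `order_slice_add_le_of_factor` (p524604; `n = 0` is vacuous: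
there is no live slot). [OURS · L1 W4.3] -/
theorem orderGrowth : ∀ n : ℕ, OrderGrowth n
  | 0 => fun _ _ _ _ _ _ _ _ _ _ _ _ i => Fin.elim0 i
  | _ + 1 => fun _ _ _ _ _ _ hc hw _ G hfac _ i hci o ho => by
      have h := order_slice_add_le_of_factor hc hw hci hfac
      rw [ho] at h
      have hlt : (TupleGame.slice i G).order < ⊤ :=
        lt_of_le_of_lt le_self_add (lt_of_le_of_lt h (by exact_mod_cast WithTop.coe_lt_top (2 * o)))
      refine ⟨(TupleGame.slice i G).order.toNat, (ENat.coe_toNat hlt.ne).symm, ?_⟩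
      rw [← ENat.coe_toNat hlt.ne] at h
      exact_mod_cast h

/-- **TOT RUNG R7 — TAME RELATIVE BINOMIALS — HOLDS, NO HYPOTHESIS** (every `m`): over an algebraically closed field of characteristic
`p`, for `p ∤ d` and non-zero `E, M, h ∈ k⟦x_0, …, x_m⟧` with `E · M · h` finitely winnable in the NC count game, the relative binomial
`E · (M · x_{m+1} ^ d + h)` is finitely winnable in `m + 2` variables.  [OURS · L1 W4.3 · rung R7 = `totRungTameBinomial_of_toric`
(res-L1-w43-strat-1) ∘ `toricStep` (p523576) ∘ `toricEnd` (p521013) ∘ `orderGrowth` (p524604).] -/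
theorem totRungTameBinomial (m : ℕ) : TOTRungTameBinomial m :=
  totRungTameBinomial_of_toric m (toricStep (m + 1)) (toricEnd (m + 1)) (orderGrowth (m + 1))

/-- **THE RELATIVE STRATEGY, HYPOTHESIS-FREE, EVERY FIELD**: left block `x_0, …, x_m`, a right block of any size `r + 1`
(`hM : m + r + 1 = M`) with first letter `x_R`, non-zero `E, M, h` on the left, `(d : k) ≠ 0`: if `E · M · h` is won within finitely many
rounds in `m + 1` variables then `relBinom hM d E M h = E · (M · x_R ^ d + h)` is won within finitely many rounds in `M + 1` variables.
[OURS · L1 W4.3] -/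
theorem exists_winsIn_relBinom_closed {m r M : ℕ} (hM : m + r + 1 = M) {d : ℕ} (hd : (d : k) ≠ 0)
    {E Mx h : MvPowerSeries (Fin (m + 1)) k} (hE : E ≠ 0) (hMx : Mx ≠ 0) (hh : h ≠ 0)
    (hwin : ∃ n, WinsIn (m := m) GermIsNC n (E * Mx * h)) : ∃ n, WinsIn (m := M) GermIsNC n (relBinom hM d E Mx h) :=
  exists_winsIn_relBinom hM (toricStep M) (toricEnd M) (orderGrowth (m + 1)) hd hE hMx hh hwin

/-! ## (K-c): the tame suspension of a plane curve, hypothesis-free -/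

/-- **(K-c) HYPOTHESIS-FREE, EVERY FIELD**: for a non-zero plane germ `c(x_0, x_1)` and `(d : k) ≠ 0` the TAME SUSPENSION
`x_2 ^ d + c(x_0, x_1)` is won by the mover of the NC count game in three variables within finitely many rounds (`x'`-win = `winsIn_plane`).
[OURS · L1 W4.3] -/
theorem exists_winsIn_tameSuspension_closed {d : ℕ} (hd : (d : k) ≠ 0) (c : MvPowerSeries (Fin 2) k) (hc : c ≠ 0) :
    ∃ n, WinsIn (m := 2) GermIsNC n (X 2 ^ d + rename Fin.castSucc c) :=
  exists_winsIn_tameSuspension (toricStep 2) (toricEnd 2) (orderGrowth 2) hd c hc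

/-- The same with the tameness spelled `IsUnit (d : k)` (the `N = 4` tame census (iv) binder). [OURS · L1 W4.3] -/
theorem exists_winsIn_tameSuspension_of_isUnit {d : ℕ} (hd : IsUnit ((d : ℕ) : k)) (c : MvPowerSeries (Fin 2) k) (hc : c ≠ 0) :
    ∃ n, WinsIn (m := 2) GermIsNC n (X 2 ^ d + rename Fin.castSucc c) :=
  exists_winsIn_tameSuspension_closed hd.ne_zero c hc

/-- In prime characteristic `p` the tameness reads `p ∤ d`. [OURS · L1 W4.3] -/
theorem exists_winsIn_tameSuspension_of_not_dvd (p : ℕ) [CharP k p] {d : ℕ} (hpd : ¬ p ∣ d) (c : MvPowerSeries (Fin 2) k)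
    (hc : c ≠ 0) : ∃ n, WinsIn (m := 2) GermIsNC n (X 2 ^ d + rename Fin.castSucc c) :=
  exists_winsIn_tameSuspension_closed (fun h0 => hpd ((CharP.cast_eq_zero_iff k p d).mp h0)) c hc

/-! ## One dimension up: tame suspensions of surface germs, modulo ⟨F-32bR⟩ -/

/-- **TAME SUSPENSIONS OF SURFACE GERMS ARE WON IN FOUR VARIABLES**, modulo the Cossart–Jannsen–Saito fact ⟨F-32bR⟩
(`exists_winsIn_germIsNC_of_CJSB`): for every non-zero `c ∈ k⟦x_0, x_1, x_2⟧` and `(d : k) ≠ 0`, the germ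
`relBinom rfl d 1 1 c = 1 · (1 · x_3 ^ d + c)` is won by the mover of the NC count game within finitely many rounds — a class of
`HTOT 3`-instances, the regime of the residual W4|₄. [OURS · L1 W4.3 · conditional on the named fact
`CossartJannsenSaito2020EmbeddedSequenceB`] -/
theorem exists_winsIn_tameSuspension_three_of_CJSB (hCJS : CossartJannsenSaito2020EmbeddedSequenceB.{0}) {d : ℕ}
    (hd : (d : k) ≠ 0) (c : MvPowerSeries (Fin 3) k) (hc : c ≠ 0) :
    ∃ n, WinsIn (m := 3) GermIsNC n (relBinom (m := 2) (r := 0) (M := 3) rfl d 1 1 c) :=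
  exists_winsIn_relBinom_closed (m := 2) (r := 0) (M := 3) rfl hd one_ne_zero one_ne_zero hc
    (by
      obtain ⟨n, hn⟩ := exists_winsIn_germIsNC_of_CJSB hCJS c hc
      exact ⟨n, by rwa [one_mul, one_mul]⟩)

/-! ## Transport to the weighted game -/

/-- A tame suspension is a non-zero series (`d ≠ 0`: the coefficient of `x_2 ^ d` is `1`). -/
theorem tameSuspension_ne_zero {d : ℕ} (hd0 : d ≠ 0) (c : MvPowerSeries (Fin 2) k) :
    (X 2 ^ d + rename Fin.castSucc c : MvPowerSeries (Fin 3) k) ≠ 0 := by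
  intro h0
  have h2 := congrArg (coeff (Finsupp.single (2 : Fin 3) d)) h0
  rw [map_add, X_pow_eq, coeff_monomial_same, coeff_rename_eq_zero, add_zero, map_zero] at h2
  · exact one_ne_zero h2
  · rintro ⟨e, he⟩
    have h3 : Finsupp.mapDomain Fin.castSucc e (2 : Fin 3) = Finsupp.single (2 : Fin 3) d (2 : Fin 3) := by rw [he]
    rw [Finsupp.mapDomain_notin_range _ _ (by rintro ⟨j, hj⟩; have := congrArg Fin.val hj; simp at this; omega),
      Finsupp.single_eq_same] at h3
    exact hd0 h3.symm

/-- **FACT-FREE WINS OF THE WEIGHTED GAME**: in characteristic `p` with `p ∤ d`, every divisor of a power of a tame suspension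
`x_2 ^ d + c(x_0, x_1)` (`c ≠ 0`) lies in the winning region `CobordantGame.Won k 3` of the local weighted resolution game
(`NCTransport.won_of_winsIn`, p507842). [OURS · L1 W4.3] -/
theorem won_of_dvd_tameSuspension_pow (p : ℕ) (hp : p.Prime) [CharP k p] {d : ℕ} (hpd : ¬ p ∣ d)
    (c : MvPowerSeries (Fin 2) k) (hc : c ≠ 0) (N : ℕ) (f : MvPowerSeries (Fin 3) k)
    (hf : f ∣ (X 2 ^ d + rename Fin.castSucc c) ^ (N + 1)) : CobordantGame.Won k 3 f := by
  obtain ⟨n, hn⟩ := exists_winsIn_tameSuspension_of_not_dvd p hpd c hc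
  have hd0 : d ≠ 0 := fun h0 => hpd (h0 ▸ dvd_zero p)
  exact won_of_winsIn p hp n _ (tameSuspension_ne_zero hd0 c) hn N f hf

end NCTransport

end Summit.ResolutionOfSingularities.ResolutionOfSingularities.Theorems
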